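import Mathlib
import HarnessLib
import Summits.HubbardSuperconductivity.HubbardSuperconductivity.Theorems.KLProgrammeAbsUmklappNarrowCount

/-!
# Route `KLProgramme` — K3 engine (stmt-HubbardSuperconductivity-20437), stub (b) (ℓ)/(I2)–(I3), located item «ABS-UMK-COUNT» / «ABS-UMK-34-SIGNPAT»:
# COVERAGE of a narrow free bundle with ≥ 3 legs by the sign-pattern classes anchored on a grid of chart centres

Cell gate-hubbard-kl, seat p4 g16 (≥ 3-free-leg twin of `exists_base_triple_of_free`, p623334).  The chart centre is no longer a free leg but a point of the grid
`θ₀ + mΦ₀ + σ′π` (`m < ⌊2π/Φ₀⌋ + 1`, `σ′ ∈ {0, 1}`; `θ₀` = the centre of a prescribed leg): if the legs of `F` (`|F| ≥ 3`) are pairwise within pair angle `Φ₀`,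
then for some grid centre `θ⋆` every leg of `F` is within pair angle `2Φ₀` of `θ⋆`, two distinct legs `a, b ∈ F` are within torus distance `2Φ₀` of `θ⋆` and a
third `c ∈ F` is within `2Φ₀` of `θ⋆` or of `θ⋆ + π` (pigeonhole on the two sides among three legs):

* torus lemmas `torusDist_neg'`, `torusDist_pi`, `torusDist_sub_pi_eq`, `pairAngle_add_pi_right`, `pairAngle_le_add_torusDist_right`, `exists_grid_shift`;
* **`exists_class34_of_free`** — the coverage statement above.

Everything is PROVED; no definitions, no named facts. [folklore]
-/

noncomputable section

open Real Set
open Literature.MathematicalPhysics.QuantumLattice Literature.MathematicalPhysics.QuantumLattice.FermiRG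
open Literature.MathematicalPhysics.QuantumLattice.FermiRG.BGM2003

namespace Summit.HubbardSuperconductivity.HubbardSuperconductivity.Theorems.AbsUmklappCount

set_option linter.dupNamespace false -- summit = problem name (single-conjunct summit), D-0017

/-! ## §1 Torus lemmas -/

/-- `‖−x‖_{𝕋¹} = ‖x‖_{𝕋¹}` (local copy in this namespace's vocabulary `FermiRG.torusDist`, used with `x = a − b`). [folklore] -/
theorem torusDist_neg' (a b : ℝ) : FermiRG.torusDist (a - b) = FermiRG.torusDist (b - a) := by
  rw [← neg_sub]; unfold FermiRG.torusDist; rw [AddCircle.coe_neg, norm_neg]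

/-- `‖π‖_{𝕋¹} = π`. [folklore] -/
theorem torusDist_pi : FermiRG.torusDist π = π := by
  rw [torusDist_eq_abs_rep]
  have h1 : (2 * π)⁻¹ * π = 1 / 2 := by field_simp
  have h2 : round ((1 : ℝ) / 2) = 1 := by
    rw [round_eq]; norm_num
  rw [h1, h2, Int.cast_one, one_mul, show π - 2 * π = -π by ring, abs_neg, abs_of_pos Real.pi_pos]

/-- `‖x − π‖_{𝕋¹} = π − ‖x‖_{𝕋¹}`. [folklore] -/
theorem torusDist_sub_pi_eq (x : ℝ) : FermiRG.torusDist (x - π) = π - FermiRG.torusDist x := by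
  refine le_antisymm (torusDist_sub_pi_le x) ?_
  have h := torusDist_sub_sub_le x (x - π) 0
  rw [show x - (x - π) = π by ring, sub_zero, sub_zero, torusDist_pi] at h
  linarith

/-- `φ(θ₁, θ₂ + π) = φ(θ₁, θ₂)`: the pair angle only sees directions modulo `π`. [folklore] -/
theorem pairAngle_add_pi_right (θ₁ θ₂ : ℝ) : pairAngle θ₁ (θ₂ + π) = pairAngle θ₁ θ₂ := by
  rw [pairAngle, pairAngle, show θ₁ - (θ₂ + π) = (θ₁ - θ₂) - π by ring, torusDist_sub_pi_eq]
  rw [show π - (π - FermiRG.torusDist (θ₁ - θ₂)) = FermiRG.torusDist (θ₁ - θ₂) by ring, min_comm]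

/-- `φ(θ₁, θ₂′) ≤ φ(θ₁, θ₂) + ‖θ₂′ − θ₂‖_{𝕋¹}` (the pair angle is `1`-Lipschitz in its second argument). [folklore] -/
theorem pairAngle_le_add_torusDist_right (θ₁ θ₂ θ₂' : ℝ) :
    pairAngle θ₁ θ₂' ≤ pairAngle θ₁ θ₂ + FermiRG.torusDist (θ₂' - θ₂) := by
  have h1 : FermiRG.torusDist (θ₁ - θ₂') ≤ FermiRG.torusDist (θ₁ - θ₂) + FermiRG.torusDist (θ₂' - θ₂) := by
    have := torusDist_sub_sub_le θ₁ θ₂' θ₂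
    linarith
  have h2 : FermiRG.torusDist (θ₁ - θ₂) ≤ FermiRG.torusDist (θ₁ - θ₂') + FermiRG.torusDist (θ₂' - θ₂) := by
    have := torusDist_sub_sub_le θ₁ θ₂ θ₂'
    rw [torusDist_neg' θ₂ θ₂'] at this
    linarith
  unfold pairAngle
  rcases le_or_gt (FermiRG.torusDist (θ₁ - θ₂)) (π - FermiRG.torusDist (θ₁ - θ₂)) with h | h
  · rw [min_eq_left h]
    exact (min_le_left _ _).trans h1
  · rw [min_eq_right h.le]
    exact (min_le_right _ _).trans (by linarith)

/-- **The grid of chart centres**: every angle is within torus distance `Φ₀` of `mΦ₀` for some `m < ⌊2π/Φ₀⌋ + 1`. [folklore] -/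
theorem exists_grid_shift (x : ℝ) {Φ₀ : ℝ} (hΦ₀ : 0 < Φ₀) :
    ∃ m : ℕ, m < ⌊2 * π / Φ₀⌋₊ + 1 ∧ FermiRG.torusDist (x - m * Φ₀) ≤ Φ₀ := by
  have h2π : 0 < 2 * π := by positivity
  -- the representative of `x` in `[0, 2π)`
  set r : ℝ := x - ⌊x / (2 * π)⌋ * (2 * π) with hr
  have hr0 : 0 ≤ r := by
    have := Int.floor_le (x / (2 * π))
    have h3 : (⌊x / (2 * π)⌋ : ℝ) * (2 * π) ≤ x := by rwa [le_div_iff₀ h2π] at this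
    rw [hr]; linarith
  have hr2 : r < 2 * π := by
    have := Int.lt_floor_add_one (x / (2 * π))
    have h3 : x < (⌊x / (2 * π)⌋ + 1) * (2 * π) := by rwa [div_lt_iff₀ h2π] at this
    rw [hr]; linarith
  set m : ℕ := ⌊r / Φ₀⌋₊ with hm
  have hm1 : (m : ℝ) ≤ r / Φ₀ := Nat.floor_le (div_nonneg hr0 hΦ₀.le)
  have hm2 : r / Φ₀ < m + 1 := Nat.lt_floor_add_one _
  refine ⟨m, ?_, ?_⟩
  · have : m ≤ ⌊2 * π / Φ₀⌋₊ := Nat.floor_le_floor (div_le_div_of_nonneg_right hr2.le hΦ₀.le)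
    omega
  · have e : x - m * Φ₀ = (r - m * Φ₀) + (⌊x / (2 * π)⌋ : ℤ) * (2 * π) := by rw [hr]; ring
    rw [e, PerturbedFermiCurve.torusDist_add_int_mul_two_pi]
    refine (PerturbedFermiCurve.torusDist_le_abs_self _).trans ?_
    have h4 : (m : ℝ) * Φ₀ ≤ r := by rwa [le_div_iff₀ hΦ₀] at hm1
    have h5 : r < (m + 1) * Φ₀ := by rwa [div_lt_iff₀ hΦ₀] at hm2
    rw [abs_of_nonneg (by linarith)]
    linarith

/-! ## §2 Coverage by the sign-pattern classes -/

open Classical in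
/-- **Coverage of a narrow free bundle with at least three legs.**  See the module docstring. [folklore] -/
theorem exists_class34_of_free {L : ℕ} (F : Finset (Fin L)) (hF : 3 ≤ F.card) (θ : Fin L → ℝ) (θ₀ : ℝ) {Φ₀ : ℝ} (hΦ₀ : 0 < Φ₀)
    (hnar : ∀ i j : Fin L, i ∈ F → j ∈ F → pairAngle (θ i) (θ j) ≤ Φ₀) :
    ∃ m : ℕ, m < ⌊2 * π / Φ₀⌋₊ + 1 ∧ ∃ σ' : ℕ, σ' < 2 ∧ ∃ a b c : Fin L, a ∈ F ∧ b ∈ F ∧ c ∈ F ∧ a ≠ b ∧ a ≠ c ∧ b ≠ c ∧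
      (∀ i ∈ F, pairAngle (θ i) (θ₀ + (m * Φ₀ + σ' * π)) ≤ 2 * Φ₀) ∧
      FermiRG.torusDist (θ a - (θ₀ + (m * Φ₀ + σ' * π))) ≤ 2 * Φ₀ ∧
      FermiRG.torusDist (θ b - (θ₀ + (m * Φ₀ + σ' * π))) ≤ 2 * Φ₀ ∧
      (FermiRG.torusDist (θ c - (θ₀ + (m * Φ₀ + σ' * π))) ≤ 2 * Φ₀ ∨
        FermiRG.torusDist (θ c - (θ₀ + (m * Φ₀ + σ' * π) + π)) ≤ 2 * Φ₀) := by
  -- three distinct legs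
  obtain ⟨x, y, z, hx, hy, hz, hxy, hxz, hyz⟩ := Finset.two_lt_card_iff.1 (by omega : 2 < F.card)
  -- the grid centre near the reference leg `x`
  obtain ⟨m, hm, hmx⟩ := exists_grid_shift (θ x - θ₀) hΦ₀
  set θc : ℝ := θ₀ + m * Φ₀ with hθc
  have hxc : FermiRG.torusDist (θ x - θc) ≤ Φ₀ := by rw [hθc, show θ x - (θ₀ + m * Φ₀) = θ x - θ₀ - m * Φ₀ by ring]; exact hmx
  -- every leg of `F` is within `2Φ₀` of `θc` or of `θc + π`, and within pair angle `2Φ₀` of `θc`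
  have hside : ∀ i ∈ F, FermiRG.torusDist (θ i - θc) ≤ 2 * Φ₀ ∨ FermiRG.torusDist (θ i - (θc + π)) ≤ 2 * Φ₀ := by
    intro i hi
    rcases torusDist_alt_of_pairAngle_le (hnar i x hi hx) with h | h
    · left
      have := torusDist_sub_sub_le (θ i) θc (θ x)
      rw [torusDist_neg' θc (θ x)] at this
      linarith
    · right
      have := torusDist_sub_sub_le (θ i) (θc + π) (θ x + π)
      rw [torusDist_neg' (θc + π) (θ x + π), show θ x + π - (θc + π) = θ x - θc by ring] at this
      linarith
  have hpair : ∀ i ∈ F, pairAngle (θ i) θc ≤ 2 * Φ₀ := by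
    intro i hi
    have h1 := pairAngle_le_add_torusDist_right (θ i) (θ x) θc
    rw [torusDist_neg' θc (θ x)] at h1
    linarith [hnar i x hi hx]
  -- the conclusion from an ordered triple `(a, b, c)` with `a, b` on the side `σ′`
  have hfinish : ∀ (σ' : ℕ) (a b c : Fin L), σ' < 2 → a ∈ F → b ∈ F → c ∈ F → a ≠ b → a ≠ c → b ≠ c →
      FermiRG.torusDist (θ a - (θc + σ' * π)) ≤ 2 * Φ₀ → FermiRG.torusDist (θ b - (θc + σ' * π)) ≤ 2 * Φ₀ →
      (FermiRG.torusDist (θ c - (θc + σ' * π)) ≤ 2 * Φ₀ ∨ FermiRG.torusDist (θ c - (θc + σ' * π + π)) ≤ 2 * Φ₀) →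
      ∃ m : ℕ, m < ⌊2 * π / Φ₀⌋₊ + 1 ∧ ∃ σ' : ℕ, σ' < 2 ∧ ∃ a b c : Fin L, a ∈ F ∧ b ∈ F ∧ c ∈ F ∧ a ≠ b ∧ a ≠ c ∧ b ≠ c ∧
        (∀ i ∈ F, pairAngle (θ i) (θ₀ + (m * Φ₀ + σ' * π)) ≤ 2 * Φ₀) ∧
        FermiRG.torusDist (θ a - (θ₀ + (m * Φ₀ + σ' * π))) ≤ 2 * Φ₀ ∧
        FermiRG.torusDist (θ b - (θ₀ + (m * Φ₀ + σ' * π))) ≤ 2 * Φ₀ ∧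
        (FermiRG.torusDist (θ c - (θ₀ + (m * Φ₀ + σ' * π))) ≤ 2 * Φ₀ ∨
          FermiRG.torusDist (θ c - (θ₀ + (m * Φ₀ + σ' * π) + π)) ≤ 2 * Φ₀) := by
    intro σ' a b c hσ' ha hb hc hab hac hbc h1 h2 h3
    have e : θ₀ + (m * Φ₀ + σ' * π) = θc + σ' * π := by rw [hθc]; ring
    refine ⟨m, hm, σ', hσ', a, b, c, ha, hb, hc, hab, hac, hbc, ?_, ?_, ?_, ?_⟩
    · intro i hi
      rw [e]
      interval_cases σ'
      · rw [Nat.cast_zero, zero_mul, add_zero]; exact hpair i hi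
      · rw [Nat.cast_one, one_mul, pairAngle_add_pi_right]; exact hpair i hi
    · rw [e]; exact h1
    · rw [e]; exact h2
    · rw [e]; exact h3
  -- side bookkeeping: `σ = 0` ↔ near `θc`, `σ = 1` ↔ near `θc + π`; `θc + π + π ≡ θc`
  have hwrap : ∀ t : ℝ, FermiRG.torusDist (t - (θc + ((1 : ℕ) : ℝ) * π + π)) = FermiRG.torusDist (t - θc) := by
    intro t
    rw [show t - (θc + ((1 : ℕ) : ℝ) * π + π) = (t - θc) + (-1 : ℤ) * (2 * π) by push_cast; ring,
      PerturbedFermiCurve.torusDist_add_int_mul_two_pi]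
  have h0 : ∀ t : ℝ, FermiRG.torusDist (t - (θc + ((0 : ℕ) : ℝ) * π)) = FermiRG.torusDist (t - θc) := fun t => by
    rw [Nat.cast_zero, zero_mul, add_zero]
  have h1' : ∀ t : ℝ, FermiRG.torusDist (t - (θc + ((0 : ℕ) : ℝ) * π + π)) = FermiRG.torusDist (t - (θc + π)) := fun t => by
    rw [Nat.cast_zero, zero_mul, add_zero]
  have h1 : ∀ t : ℝ, FermiRG.torusDist (t - (θc + ((1 : ℕ) : ℝ) * π)) = FermiRG.torusDist (t - (θc + π)) := fun t => by
    rw [Nat.cast_one, one_mul]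
  -- pigeonhole on the sides of `x, y, z`
  rcases hside x hx with hx0 | hx1 <;> rcases hside y hy with hy0 | hy1
  · -- `x, y` near `θc`
    refine hfinish 0 x y z (by norm_num) hx hy hz hxy hxz hyz (by rw [h0]; exact hx0) (by rw [h0]; exact hy0) ?_
    rcases hside z hz with hz0 | hz1
    · left; rw [h0]; exact hz0
    · right; rw [h1']; exact hz1
  · -- `x` near `θc`, `y` near `θc + π`
    rcases hside z hz with hz0 | hz1
    · refine hfinish 0 x z y (by norm_num) hx hz hy hxz hxy hyz.symm (by rw [h0]; exact hx0) (by rw [h0]; exact hz0) ?_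
      right; rw [h1']; exact hy1
    · refine hfinish 1 y z x (by norm_num) hy hz hx hyz hxy.symm hxz.symm (by rw [h1]; exact hy1) (by rw [h1]; exact hz1) ?_
      right; rw [hwrap]; exact hx0
  · -- `x` near `θc + π`, `y` near `θc`
    rcases hside z hz with hz0 | hz1
    · refine hfinish 0 y z x (by norm_num) hy hz hx hyz hxy.symm hxz.symm (by rw [h0]; exact hy0) (by rw [h0]; exact hz0) ?_
      right; rw [h1']; exact hx1
    · refine hfinish 1 x z y (by norm_num) hx hz hy hxz hxy hyz.symm (by rw [h1]; exact hx1) (by rw [h1]; exact hz1) ?_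
      right; rw [hwrap]; exact hy0
  · -- `x, y` near `θc + π`
    refine hfinish 1 x y z (by norm_num) hx hy hz hxy hxz hyz (by rw [h1]; exact hx1) (by rw [h1]; exact hy1) ?_
    rcases hside z hz with hz0 | hz1
    · right; rw [hwrap]; exact hz0
    · left; rw [h1]; exact hz1

end Summit.HubbardSuperconductivity.HubbardSuperconductivity.Theorems.AbsUmklappCount

end
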